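import Summits.Ventures.QEC.Thresholds.HypergraphProductBoxThresholds
import Summits.Ventures.QEC.Thresholds.HypergraphProductGallager34Thresholds
import Summits.Ventures.QEC.Thresholds.ToricCodeHGPThresholds
import HarnessLib

/-!
# Two-rate phenomenological threshold BOXES for the toric-as-HGP family (`p₀(5)`) and the `(3,4)`-bounded Gallager
# HGP class (`p₀(8)`) — UNCONDITIONAL

Venture QEC, `Summits/Ventures/QEC/Thresholds/` (LADDER-QEC rung Q5; qec-type-09 gen 4, item 09.ANISO; continues
`ToricCodeHGPThresholds.lean` and `HypergraphProductGallager34Thresholds.lean`, whose phenomenological rows are for `q = p`).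
Through `hgp_z/x_phenom_isThresholdBoxLowerBound` (`HypergraphProductBoxThresholds.lean`) the same seed data certify the whole
SQUARE of (qubit rate `p`, measurement rate `q`) pairs: every `0 ≤ p, q < p₀` is below threshold for every polynomially
bounded schedule and every minimum-weight space-time decoder family. UNCONDITIONAL, tier CERTIFIED (kernel), axioms standard,
0 facts:

| theorem | statement |
|---|---|
| `toricHGP_z_phenom_isThresholdBoxLowerBound`, `toricHGP_x_…` | toric codes `HGP(circ_{k+2}, circ_{k+2})`, `T(k)` rounds: box `p₀(5) ≈ .0101` |
| `gallager34_z_phenom_isThresholdBoxLowerBound`, `gallager34_x_…` | `(3,4)`-bounded seed families (`IsDegreeBounded _ 3 4`): box `p₀(8) ≈ .0039` |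

## References
* [DumerKovalevPryadko2015] I. Dumer, A. A. Kovalev, L. P. Pryadko, PRL 115 (2015) 050502, Thm 3, p. 5 (w → w + 2).
* [DennisEtAl2002] E. Dennis, A. Kitaev, A. Landahl, J. Preskill, J. Math. Phys. 43 (2002) 4452, §5.3 eq. (threshold_iso).
-/

noncomputable section

namespace Summit.Ventures.QEC.Thresholds

open Filter Topology Finset Matrix
open Literature.InformationTheory.QuantumCodes
open Literature.InformationTheory.Coding (minDist)

/-! ### Toric codes as hypergraph products -/

/-- **Two-rate box `p₀(5)`, `Z`-sector, toric codes as hypergraph products**: every `0 ≤ p, q < p₀(5)` (qubit rate,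
measurement rate) is below threshold, for every poly-bounded schedule and every minimum-weight space-time decoder family.
UNCONDITIONAL. [cite: DumerKovalevPryadko2015, Thm 3 with p. 5 (w → w + 2)] -/
theorem toricHGP_z_phenom_isThresholdBoxLowerBound {T : ℕ → ℕ} (hT : ToricCode.IsPolyBounded T)
    (D : ∀ k, CSSPhenom.STDecoder (Fin (k + 2) × Fin (k + 2))
      ((Fin (k + 2) × Fin (k + 2)) ⊕ (Fin (k + 2) × Fin (k + 2))) (T k))
    (hD : ∀ k, (D k).IsMinWeight (CSSPhenom.stSyn (toricHGPCode k).HX (T k))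
      (CSSPhenom.stCycles (toricHGPCode k).HX (T k)) hammingNorm) :
    IsThresholdBoxLowerBound (zPhenomFailureFamily₂ (fun k => toricHGPCode k) T D) (thresholdValue 5) := by
  have h := hgp_z_phenom_isThresholdBoxLowerBound (fun k => cycMatrix k) (fun k => cycMatrix k) T D hD
    (c₁ := 2) (q₂ := 2) (fun k => hammingNorm_cycMatrix_row_le k) (fun k => hammingNorm_cycMatrix_col_le k)
    (fun k => k + 2) (fun k => by omega) (fun k => le_minDist_pcCode_cycMatrix k)
    (fun k => le_minDist_pcCode_cycMatrix_transpose k) (fun r hr0 hr1 => toricHGP_phenom_growth hT hr0 hr1)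
  norm_num at h
  exact h

/-- **Two-rate box `p₀(5)`, `X`-sector**, toric codes as hypergraph products. UNCONDITIONAL.
[cite: DumerKovalevPryadko2015, Thm 3 with p. 5 (w → w + 2)] -/
theorem toricHGP_x_phenom_isThresholdBoxLowerBound {T : ℕ → ℕ} (hT : ToricCode.IsPolyBounded T)
    (D : ∀ k, CSSPhenom.STDecoder (Fin (k + 2) × Fin (k + 2))
      ((Fin (k + 2) × Fin (k + 2)) ⊕ (Fin (k + 2) × Fin (k + 2))) (T k))
    (hD : ∀ k, (D k).IsMinWeight (CSSPhenom.stSyn (toricHGPCode k).HZ (T k))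
      (CSSPhenom.stCycles (toricHGPCode k).HZ (T k)) hammingNorm) :
    IsThresholdBoxLowerBound (xPhenomFailureFamily₂ (fun k => toricHGPCode k) T D) (thresholdValue 5) := by
  have h := hgp_x_phenom_isThresholdBoxLowerBound (fun k => cycMatrix k) (fun k => cycMatrix k) T D hD
    (q₁ := 2) (c₂ := 2) (fun k => hammingNorm_cycMatrix_col_le k) (fun k => hammingNorm_cycMatrix_row_le k)
    (fun k => k + 2) (fun k => by omega) (fun k => le_minDist_pcCode_cycMatrix_transpose k)
    (fun k => le_minDist_pcCode_cycMatrix k) (fun r hr0 hr1 => toricHGP_phenom_growth hT hr0 hr1)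
  norm_num at h
  exact h

/-! ### `(3,4)`-bounded Gallager seeds -/

section Family

variable {m₁ n₁ m₂ n₂ : ℕ → ℕ}

/-- **Two-rate box `p₀(8) ≈ .0039`, `Z`-sector, `(3,4)`-bounded seeds** (space-time check weight `7 + 2`, growth
`(n₁n₂ + m₁m₂ + m₁n₂)·T i·r^{d i} → 0`, ANY minimum-weight space-time decoders): every `0 ≤ p, q < p₀(8)` below threshold.
UNCONDITIONAL. [cite: DumerKovalevPryadko2015, Thm 3 with p. 5 (w → w + 2, w = 7)] -/
theorem gallager34_z_phenom_isThresholdBoxLowerBound (H₁ : ∀ i, Matrix (Fin (m₁ i)) (Fin (n₁ i)) (ZMod 2))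
    (H₂ : ∀ i, Matrix (Fin (m₂ i)) (Fin (n₂ i)) (ZMod 2))
    (hB₁ : ∀ i, IsDegreeBounded (H₁ i) 3 4) (hB₂ : ∀ i, IsDegreeBounded (H₂ i) 3 4) (T : ℕ → ℕ)
    (D : ∀ i, CSSPhenom.STDecoder (Fin (m₁ i) × Fin (n₂ i))
      ((Fin (n₁ i) × Fin (n₂ i)) ⊕ (Fin (m₁ i) × Fin (m₂ i))) (T i))
    (hD : ∀ i, (D i).IsMinWeight (CSSPhenom.stSyn (HGP.code (H₁ i) (H₂ i)).HX (T i))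
      (CSSPhenom.stCycles (HGP.code (H₁ i) (H₂ i)).HX (T i)) hammingNorm)
    (d : ℕ → ℕ) (hd1 : ∀ i, 1 ≤ d i)
    (hd₁ : ∀ i, (d i : ℕ∞) ≤ minDist (pcCode (H₁ i))) (hd₂ : ∀ i, (d i : ℕ∞) ≤ minDist (pcCode (H₂ i)ᵀ))
    (hgrowth : ∀ r : ℝ, 0 < r → r < 1 →
      Tendsto (fun i => (((n₁ i * n₂ i + m₁ i * m₂ i + m₁ i * n₂ i) * T i : ℕ) : ℝ) * r ^ d i)
        atTop (𝓝 0)) :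
    IsThresholdBoxLowerBound (zPhenomFailureFamily₂ (fun i => HGP.code (H₁ i) (H₂ i)) T D) (thresholdValue 8) := by
  have h := hgp_z_phenom_isThresholdBoxLowerBound H₁ H₂ T D hD (c₁ := 4) (q₂ := 3)
    (fun i => (hB₁ i).2) (fun i => (hB₂ i).1) d hd1 hd₁ hd₂ hgrowth
  norm_num at h
  exact h

/-- **Two-rate box `p₀(8)`, `X`-sector, `(3,4)`-bounded seeds**. UNCONDITIONAL.
[cite: DumerKovalevPryadko2015, Thm 3 with p. 5 (w → w + 2, w = 7)] -/
theorem gallager34_x_phenom_isThresholdBoxLowerBound (H₁ : ∀ i, Matrix (Fin (m₁ i)) (Fin (n₁ i)) (ZMod 2))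
    (H₂ : ∀ i, Matrix (Fin (m₂ i)) (Fin (n₂ i)) (ZMod 2))
    (hB₁ : ∀ i, IsDegreeBounded (H₁ i) 3 4) (hB₂ : ∀ i, IsDegreeBounded (H₂ i) 3 4) (T : ℕ → ℕ)
    (D : ∀ i, CSSPhenom.STDecoder (Fin (n₁ i) × Fin (m₂ i))
      ((Fin (n₁ i) × Fin (n₂ i)) ⊕ (Fin (m₁ i) × Fin (m₂ i))) (T i))
    (hD : ∀ i, (D i).IsMinWeight (CSSPhenom.stSyn (HGP.code (H₁ i) (H₂ i)).HZ (T i))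
      (CSSPhenom.stCycles (HGP.code (H₁ i) (H₂ i)).HZ (T i)) hammingNorm)
    (d : ℕ → ℕ) (hd1 : ∀ i, 1 ≤ d i)
    (hd₁ : ∀ i, (d i : ℕ∞) ≤ minDist (pcCode (H₁ i)ᵀ)) (hd₂ : ∀ i, (d i : ℕ∞) ≤ minDist (pcCode (H₂ i)))
    (hgrowth : ∀ r : ℝ, 0 < r → r < 1 →
      Tendsto (fun i => (((n₁ i * n₂ i + m₁ i * m₂ i + n₁ i * m₂ i) * T i : ℕ) : ℝ) * r ^ d i)
        atTop (𝓝 0)) :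
    IsThresholdBoxLowerBound (xPhenomFailureFamily₂ (fun i => HGP.code (H₁ i) (H₂ i)) T D) (thresholdValue 8) := by
  have h := hgp_x_phenom_isThresholdBoxLowerBound H₁ H₂ T D hD (q₁ := 3) (c₂ := 4)
    (fun i => (hB₁ i).1) (fun i => (hB₂ i).2) d hd1 hd₁ hd₂ hgrowth
  norm_num at h
  exact h

end Family

end Summit.Ventures.QEC.Thresholds

end
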